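import Summits.QuantumFields.BalabanUV.T4Continuum.Support.NE9LinSizeKP
import Summits.QuantumFields.BalabanUV.T4Continuum.Support.NE9MultiScaleChart

/-!
# NE9 (node U3, history side) — repair item NE9-F8 «d-CURRENCY DISCHARGERS», part 4: the MULTI-SCALE twin — the three
geometry∕entropy binders of the NE9 END faces on the lineage's multi-scale chart `NE9MultiScaleChart.msChart`, in the currency of
`d_k = linSize`, where the pin-budget comparability is `κ ≤ a″` EXACTLY

Cell `pub-balaban`, T⁴ programme, row NE9; unit `b2b-balaban-t4-ne9-formalise-leaf-05-g2` (crew row (w13), parts 1a∕1b =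
`Support/NE9LinSizeEntropy` ∕ `Support/NE9LinSizeKP`).  Part 1b serves SINGLE-SCALE cube charts over `Fin ν → G` (the torus END E5′
of `…-leaf-10-g2`, `Support/NE9LinSizeEnd`); the lineage's own carriers of [II] §2 are MULTI-SCALE (`msCarriers`: domain indices =
(creation step k, wall-connected family of `T^{(k)}`), `d = linSize` = d_k; `msChart`: sigma sites `Site ν n = Σ k, Fin ν → ZMod (n k)`,
adjacency `SAdj`).  THIS FILE transports part 1b to `msChart` through road P2's fibre API (F3: `fibreProj`, `isConn_image_fibreProj`,
`image_fibreProj_map`, `mem_region_iff`):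

* §1 fibre bookkeeping: a step-volume polymer of `X` lives on the fibre of scale `X.1`, is recovered from its projection
  (`eq_map_image_fibreProj`), so projection is injective on the step volume and preserves cardinality; `SAdj` projects to `WallAdj`;
* §2 `msLinSize γ` := the linear size of `γ` read on the fibre of (any of) its sites — for a step-volume polymer of `X` it is
  `linSize (γ.image (fibreProj X.1))` (`msLinSize_eq`);
* §3 **`msChart_kpClause_of_linSizeDecay`** — the `hkp` clause of `TwoPointKP` on `msChart` with weights `a = sizeWeight a₁`,
  `d = fun γ => a″·(msLinSize γ + (ν+1))`, from a majorant decaying in `msLinSize` (∘ part 1b's `kp_of_linSizeDecay_touch` on the fibre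
  torus, additive rate condition and smallness VERBATIM);
* §4 **`msChart_decayExtract_linSize`** — `DecayExtract (fun X => a″·(linSize X.2.1 + (ν+1))) d` = (2.27)
  (`linSize_biUnion_add_le_sum` on the fibre, BY NAME); **`msChart_pinBudget_linSize`** — `PinBudget (sizeWeight a₁) δ
  (fun _ => a₁·e^{−a″(ν+1)}) κ` under **`κ ≤ a″`** (the carriers' `d X` IS `linSize X.2.1`, `NE9MultiScaleChart.d_eq`).

[folklore] lattice bookkeeping; ONE data `def` (`msLinSize`), no `def … : Prop`, no END face re-wired.  HONEST FRAMING: bookkeeping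
for rung (B)+1 on a FIXED finite four-torus; discharges nothing about Bałaban's activities (the (2.38)-TYPE decay in d_k of the
configuration-free majorant, uniformly over admissible tables, stays DISPLAYED — G-ne9p2-5); NE9 NOT PRINTED, NOT PROVED («NE9 ⇐
the named binders»); spine 0∕9; NOT infinite volume, NOT a mass gap, NOT Clay.  HONEST DEPENDENCY: continuum YM on T⁴ ⇐ BetaPertH ∧
nine spine estimates (0/9 proved); BetaPertH ⇐ (D1) ∧ (D4) ∧ CAP+tail; G-an2-4 gates asym, D1 and NE2/3/4.

References (TYPES only): [I] = [Balaban1987RG1] p.257; [II] = [Balaban1988RG2Cluster] (1.26) p.8, (2.11)–(2.13) p.14, (2.27),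
(2.30) p.18, Lemma 3 (2.38) p.20, (2.40)–(2.41) p.21; [KoteckyPreiss1986] (1)–(3).
-/

noncomputable section

namespace Summit.QuantumFields.BalabanUV.T4Continuum.NE9LinSizeKPMultiScale

open scoped BigOperators
open Literature.MathematicalPhysics.QuantumFieldTheory
open Literature.MathematicalPhysics.QuantumFieldTheory.Balaban1983to89
open Literature.MathematicalPhysics.QuantumFieldTheory.Balaban1983to89.T4OutputRate
open Literature.MathematicalPhysics.QuantumFieldTheory.Balaban1983to89.T4HistoryLipschitzActivity (ClusterGeom)
open Literature.MathematicalPhysics.QuantumFieldTheory.Balaban1983to89.T4HistoryLipschitzEntropy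
open Literature.MathematicalPhysics.QuantumFieldTheory.Balaban1983to89.T4HistoryLipschitzCubeGeometry
open Literature.MathematicalPhysics.QuantumFieldTheory.Balaban1983to89.T4HistoryLipschitzLinearSize
open Summit.QuantumFields.BalabanUV.T4Continuum.NE9MultiScaleChart
open Summit.QuantumFields.BalabanUV.T4Continuum.NE9LinSizeKP

/-! ## §1 Fibre bookkeeping -/

section Fibre

variable {ν : ℕ} {n : ℕ → ℕ} [∀ k, NeZero (n k)]

/-- a family of sites of ONE scale `k` is the embedding of its projection to the fibre of scale `k`. [folklore] -/
theorem eq_map_image_fibreProj {k : ℕ} {γ : Finset (Site ν n)} (hS : ∀ b ∈ γ, b.1 = k) :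
    γ = (γ.image (fibreProj (n := n) k)).map (embed ν n k) := by
  classical
  ext b
  constructor
  · intro hb
    obtain ⟨kb, y⟩ := b
    have hk : kb = k := hS _ hb
    subst hk
    exact Finset.mem_map.2 ⟨y, Finset.mem_image.2 ⟨⟨kb, y⟩, hb, fibreProj_mk y⟩, rfl⟩
  · intro hb
    obtain ⟨y, hy, rfl⟩ := Finset.mem_map.1 hb
    obtain ⟨b', hb', hyb⟩ := Finset.mem_image.1 hy
    obtain ⟨kb', y'⟩ := b'
    have hk : kb' = k := hS _ hb'
    subst hk
    rw [fibreProj_mk] at hyb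
    subst hyb
    exact hb'

/-- projection to the fibre preserves the number of cubes of a one-scale family. [folklore] -/
theorem card_image_fibreProj {k : ℕ} {γ : Finset (Site ν n)} (hS : ∀ b ∈ γ, b.1 = k) :
    (γ.image (fibreProj (n := n) k)).card = γ.card := by
  conv_rhs => rw [eq_map_image_fibreProj hS, Finset.card_map]

/-- projection to the fibre is injective on one-scale families. [folklore] -/
theorem eq_of_image_fibreProj_eq {k : ℕ} {γ₁ γ₂ : Finset (Site ν n)} (h₁ : ∀ b ∈ γ₁, b.1 = k) (h₂ : ∀ b ∈ γ₂, b.1 = k)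
    (h : γ₁.image (fibreProj (n := n) k) = γ₂.image (fibreProj (n := n) k)) : γ₁ = γ₂ := by
  rw [eq_map_image_fibreProj h₁, eq_map_image_fibreProj h₂, h]

/-- the scale-tagged adjacency projects to the wall adjacency of the fibre. [folklore] -/
theorem wallAdj_fibreProj_of_sAdj {k : ℕ} {x x' : Site ν n} (hx : x.1 = k) (h : SAdj ν n x x') :
    WallAdj (fibreProj (n := n) k x) (fibreProj (n := n) k x') := by
  obtain ⟨kx, y⟩ := x
  obtain ⟨kx', y'⟩ := x'
  have h1 : kx = kx' := h.1
  cases hx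
  subst h1
  rw [fibreProj_mk, fibreProj_mk]
  exact (sAdj_mk_iff y y').1 h

variable (ν n) (BgA BgB : Type) (gauge : BgA → BgA → ℝ) (gauge_nonneg : ∀ U U', 0 ≤ gauge U U') (transport : BgB → BgA)

/-- a step-volume polymer of `X` lives on the fibre of scale `X.1`. [folklore] -/
theorem scale_of_mem_vol (X : (msCarriers ν n BgA BgB gauge gauge_nonneg transport).Dom) {γ : Finset (Site ν n)}
    (hγ : γ ∈ (msChart ν n BgA BgB gauge gauge_nonneg transport).vol X) : ∀ b ∈ γ, b.1 = X.1 := fun b hb =>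
  (mem_region_iff ν n BgA BgB gauge gauge_nonneg transport X b).1
    ((((msChart ν n BgA BgB gauge gauge_nonneg transport).mem_vol).1 hγ).1 hb)

/-- a step-volume polymer of `X` projects to a wall-connected family of the fibre `T^{(X.1)}`. [folklore] -/
theorem isConn_image_of_mem_vol (X : (msCarriers ν n BgA BgB gauge gauge_nonneg transport).Dom) {γ : Finset (Site ν n)}
    (hγ : γ ∈ (msChart ν n BgA BgB gauge gauge_nonneg transport).vol X) :
    ∃ a ∈ γ.image (fibreProj (n := n) X.1), Polymer.IsConn WallAdj (γ.image (fibreProj (n := n) X.1)) a := by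
  obtain ⟨-, a, ha, hconn⟩ := ((msChart ν n BgA BgB gauge gauge_nonneg transport).mem_vol).1 hγ
  exact ⟨fibreProj X.1 a, Finset.mem_image_of_mem _ ha,
    isConn_image_fibreProj (scale_of_mem_vol ν n BgA BgB gauge gauge_nonneg transport X hγ) hconn⟩

end Fibre

/-! ## §2 The linear size of a multi-scale polymer, read on its own fibre -/

section LinSize

variable {ν : ℕ} {n : ℕ → ℕ}

/-- **the linear size `d(γ)` of a multi-scale polymer**: the lattice-edge linear size of `γ` read on the fibre of the scale of one
of its sites (`0` for the empty family); for a step-volume polymer of `X` it is `linSize (γ.image (fibreProj X.1))` = Bałaban's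
`d_k`, `k = X.1` (`msLinSize_eq`). [cite: Balaban1987RG1, p.257] -/
def msLinSize (γ : Finset (Site ν n)) : ℕ :=
  if h : γ.Nonempty then fibreLinSize (n := n) h.choose.1 γ else 0

/-- on a nonempty one-scale family the multi-scale linear size is the linear size of its fibre projection. [folklore] -/
theorem msLinSize_eq {k : ℕ} {γ : Finset (Site ν n)} (hS : ∀ b ∈ γ, b.1 = k) (hne : γ.Nonempty) :
    msLinSize γ = linSize (γ.image (fibreProj (n := n) k)) := by
  rw [msLinSize, dif_pos hne]
  have hk : hne.choose.1 = k := hS _ hne.choose_spec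
  rw [hk]; rfl

end LinSize

/-! ## §3 The Kotecký–Preiss clause on the multi-scale chart from decay in `d_k` (additive rate condition) -/

section Chart

variable (ν : ℕ) (n : ℕ → ℕ) [∀ k, NeZero (n k)]
variable (BgA BgB : Type) (gauge : BgA → BgA → ℝ) (gauge_nonneg : ∀ U U', 0 ≤ gauge U U') (transport : BgB → BgA)

/-- **THE `hkp` CLAUSE ON THE MULTI-SCALE CHART FROM DECAY IN d_k (kernel).**  For a nonnegative majorant with
`M k (g k) U γ′ ≤ ε k·e^{a₀·#γ′}·e^{−a′·d(γ′)}` (`d = msLinSize`) on every step volume at the occurring couplings, the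
ADDITIVE rate condition `2^ν·log 2 + log(8ν) ≤ a′ − a″ − 2^ν·(a₁ + a₀)` and the smallness
`(2ν+1)·ε k·e^{a″(ν+1)+2^ν(a₁+a₀)}·2^(ν+1+2^ν) ≤ a₁`: the Kotecký–Preiss clause with `a = sizeWeight a₁`,
`d γ = a″·(d(γ) + (ν+1))` — part 1b's `kp_of_linSizeDecay_touch` run on the
fibre torus `T^{(X.1)}` through `fibreProj X.1` (injective on the step volume, `SAdj ↦ WallAdj`).
[cite: KoteckyPreiss1986, (1)-(3); Balaban1988RG2Cluster, (1.26) p.8, Lemma 3 (2.38) p.20 and (2.39)-(2.41) p.21] -/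
theorem msChart_kpClause_of_linSizeDecay {Bg : Type} {W : Set (ℕ → ℝ)} {M : ℕ → ℝ → Bg → Finset (Site ν n) → ℝ}
    {ε : ℕ → ℝ} {a' a'' a₁ a₀ : ℝ} (hε : ∀ k, 0 ≤ ε k) (hM0 : ∀ k s U γ', 0 ≤ M k s U γ')
    (hdec : ∀ g ∈ W, ∀ (k : ℕ) (U : Bg) (X : (msCarriers ν n BgA BgB gauge gauge_nonneg transport).Dom),
      (msCarriers ν n BgA BgB gauge gauge_nonneg transport).scale X = k + 1 →
      ∀ γ' ∈ (msChart ν n BgA BgB gauge gauge_nonneg transport).vol X,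
      M k (g k) U γ' ≤ ε k * Real.exp (a₀ * γ'.card) * Real.exp (-(a' * (msLinSize γ' : ℝ))))
    (ha₁ : 0 ≤ a₁) (ha₀ : 0 ≤ a₀)
    (hrate : (2:ℝ) ^ ν * Real.log 2 + Real.log (8 * ν) ≤ a' - a'' - 2 ^ ν * (a₁ + a₀))
    (hsmall : ∀ k, (((2 * ν : ℕ) : ℝ) + 1) * ε k * Real.exp (a'' * (ν + 1) + 2 ^ ν * (a₁ + a₀)) * 2 ^ (ν + 1 + 2 ^ ν) ≤ a₁) :
    ∀ g ∈ W, ∀ (k : ℕ) (U : Bg) (X : (msCarriers ν n BgA BgB gauge gauge_nonneg transport).Dom),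
      (msCarriers ν n BgA BgB gauge gauge_nonneg transport).scale X = k + 1 →
      ∀ γ ∈ (msChart ν n BgA BgB gauge gauge_nonneg transport).geom.vol X,
      ∑ γ' ∈ (msChart ν n BgA BgB gauge gauge_nonneg transport).geom.vol X with
          (msChart ν n BgA BgB gauge gauge_nonneg transport).geom.inc γ' γ,
        M k (g k) U γ' * Real.exp ((msChart ν n BgA BgB gauge gauge_nonneg transport).supported.sizeWeight a₁ γ' +
          a'' * ((msLinSize γ' : ℝ) + (ν + 1))) ≤
        (msChart ν n BgA BgB gauge gauge_nonneg transport).supported.sizeWeight a₁ γ := by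
  classical
  intro g hg k U X hX γ hγ
  have hSof : ∀ γ' ∈ (msChart ν n BgA BgB gauge gauge_nonneg transport).vol X, ∀ b ∈ γ', b.1 = X.1 :=
    fun γ' hγ' => scale_of_mem_vol ν n BgA BgB gauge gauge_nonneg transport X hγ'
  have hne : ∀ γ' ∈ (msChart ν n BgA BgB gauge gauge_nonneg transport).vol X, γ'.Nonempty :=
    fun γ' hγ' => nonempty_of_mem_connFamilies hγ'
  -- part 1b on the fibre torus `T^{(X.1)}`
  have h := kp_of_linSizeDecay_touch (inc := (msChart ν n BgA BgB gauge gauge_nonneg transport).geom.inc)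
    (torusAdj ν (n X.1)) (2 * ν)
    (card_filter_torusAdj_le (ν := ν) (N := n X.1)) (fun _ _ h => h)
    (L := (msChart ν n BgA BgB gauge gauge_nonneg transport).vol X)
    (supp := fun γ' => γ'.image (fibreProj (n := n) X.1)) (Λ := Finset.univ)
    (fun _ _ => Finset.subset_univ _)
    (fun γ' hγ' => isConn_image_of_mem_vol ν n BgA BgB gauge gauge_nonneg transport X hγ')
    (fun γ₁ h₁ γ₂ h₂ h12 => eq_of_image_fibreProj_eq (hSof γ₁ h₁) (hSof γ₂ h₂) h12)
    (fun γ' hγ' γ₀ hinc => by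
      obtain ⟨x, hx, x', hx', hxx'⟩ :=
        (msChart ν n BgA BgB gauge gauge_nonneg transport).supported.touch X γ' hγ' γ₀ hinc
      have hx'k : x'.1 = X.1 := hSof γ' hγ' x' hx'
      have hxk : x.1 = X.1 := by
        rcases hxx' with rfl | hadj
        · exact hx'k
        · exact hadj.1.trans hx'k
      refine ⟨fibreProj X.1 x, Finset.mem_image_of_mem _ hx, fibreProj X.1 x', Finset.mem_image_of_mem _ hx', ?_⟩
      rcases hxx' with rfl | hadj
      · exact Or.inl rfl
      · exact Or.inr (wallAdj_fibreProj_of_sAdj hxk hadj))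
    (m := fun γ' => M k (g k) U γ') (hε k) (hM0 k (g k) U)
    (fun γ' hγ' => by
      have h1 := hdec g hg k U X hX γ' hγ'
      rwa [msLinSize_eq (hSof γ' hγ') (hne γ' hγ'), ← card_image_fibreProj (hSof γ' hγ')] at h1)
    ha₁ ha₀ hrate (hsmall k) γ
  -- read the conclusion back on the sigma sites
  have hγk := hSof γ hγ
  rw [card_image_fibreProj hγk] at h
  refine le_of_eq_of_le (Finset.sum_congr rfl fun γ' hγ' => ?_) h
  have hγ'v : γ' ∈ (msChart ν n BgA BgB gauge gauge_nonneg transport).vol X := (Finset.mem_filter.1 hγ').1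
  rw [card_image_fibreProj (hSof γ' hγ'v), ← msLinSize_eq (hSof γ' hγ'v) (hne γ' hγ'v)]
  rfl

/-! ## §4 `DecayExtract` = (2.27) on the fibre; `PinBudget` with `κ ≤ a″` exactly -/

/-- **(2.27) ON THE MULTI-SCALE CHART (kernel).**  A localizing family `K` of `X` consists of step-volume polymers
whose union is the embedded family of `X`; projected to the fibre of scale `X.1` it is a family of wall-connected families with union
`X.2.1` (wall-connected by the carriers' definition), so `T4HistoryLipschitzLinearSize.linSize_biUnion_add_le_sum` gives
`d(X) + (ν+1) ≤ Σ_{γ∈K} (d(γ) + (ν+1))` — [II] (2.27) p.18 with `5 = ν + 1`.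
[cite: Balaban1988RG2Cluster, (2.27) p.18 and (2.13) p.14; Balaban1987RG1, p.257] -/
theorem sum_linSizeWeight_ge_of_mem_clus {a'' : ℝ} (ha'' : 0 ≤ a'') (X : (msCarriers ν n BgA BgB gauge gauge_nonneg transport).Dom)
    (K : Finset (Finset (Site ν n)))
    (hK : K ∈ (msChart ν n BgA BgB gauge gauge_nonneg transport).clus X) :
    a'' * ((linSize X.2.1 : ℝ) + (ν + 1)) ≤ ∑ γ ∈ K, a'' * ((msLinSize (n := n) γ : ℝ) + (ν + 1)) := by
  classical
  obtain ⟨hKvol, hU⟩ := (msChart ν n BgA BgB gauge gauge_nonneg transport).mem_clus.1 hK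
  have hSof : ∀ γ' ∈ K, ∀ b ∈ γ', b.1 = X.1 :=
    fun γ' hγ' => scale_of_mem_vol ν n BgA BgB gauge gauge_nonneg transport X (hKvol hγ')
  have hne : ∀ γ' ∈ K, γ'.Nonempty := fun γ' hγ' => nonempty_of_mem_connFamilies (hKvol hγ')
  -- the projected family
  set K' : Finset (Finset (Fin ν → ZMod (n X.1))) := K.image fun γ => γ.image (fibreProj (n := n) X.1) with hK'
  have hKne : K.Nonempty := by
    obtain ⟨c, hc⟩ := (msChart ν n BgA BgB gauge gauge_nonneg transport).cubes_nonempty X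
    rw [← hU] at hc
    obtain ⟨Y, hY, -⟩ := Finset.mem_biUnion.1 hc
    exact ⟨Y, hY⟩
  have hK'ne : K'.Nonempty := hKne.image _
  have hsk : ∀ Y ∈ K', ∃ S, IsSkeleton Y S := by
    intro Y hY
    obtain ⟨γ', hγ', rfl⟩ := Finset.mem_image.1 hY
    obtain ⟨a, _, ha⟩ := isConn_image_of_mem_vol ν n BgA BgB gauge gauge_nonneg transport X (hKvol hγ')
    exact ⟨_, isSkeleton_self_of_isConn ha⟩
  have hY : ∀ Y ∈ K', Y.Nonempty := by
    intro Y hY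
    obtain ⟨γ', hγ', rfl⟩ := Finset.mem_image.1 hY
    exact (hne γ' hγ').image _
  have hUnion : K'.biUnion id = X.2.1 := by
    have h1 : K'.biUnion id = (K.biUnion id).image (fibreProj (n := n) X.1) := by
      rw [hK', Finset.image_biUnion, Finset.biUnion_image]; rfl
    have h2 : (K.biUnion id).image (fibreProj (n := n) X.1) = X.2.1 := by
      rw [hU]; exact image_fibreProj_map X.2.1
    exact h1.trans h2
  obtain ⟨a, _, ha⟩ := X.2.2
  have h227 := linSize_biUnion_add_le_sum hK'ne hsk hY (a := a) (by rw [hUnion]; exact ha)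
  rw [hUnion] at h227
  have h' : (linSize X.2.1 : ℝ) + (ν + 1) ≤ ∑ Y ∈ K', ((linSize Y : ℝ) + (ν + 1)) := by exact_mod_cast h227
  have hinj : Set.InjOn (fun γ : Finset (Site ν n) => γ.image (fibreProj (n := n) X.1)) K :=
    fun γ₁ h₁ γ₂ h₂ h12 => eq_of_image_fibreProj_eq (hSof γ₁ h₁) (hSof γ₂ h₂) h12
  have hsum : ∑ Y ∈ K', ((linSize Y : ℝ) + (ν + 1)) = ∑ γ ∈ K, ((msLinSize (n := n) γ : ℝ) + (ν + 1)) := by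
    rw [hK', Finset.sum_image hinj]
    refine Finset.sum_congr rfl fun γ hγ => ?_
    rw [msLinSize_eq (hSof γ hγ) (hne γ hγ)]
  calc a'' * ((linSize X.2.1 : ℝ) + (ν + 1)) ≤ a'' * ∑ Y ∈ K', ((linSize Y : ℝ) + (ν + 1)) :=
        mul_le_mul_of_nonneg_left h' ha''
    _ = ∑ γ ∈ K, a'' * ((msLinSize (n := n) γ : ℝ) + (ν + 1)) := by rw [hsum, Finset.mul_sum]

/-- **`DecayExtract` ON THE MULTI-SCALE CHART IS (2.27) (kernel)** — `sum_linSizeWeight_ge_of_mem_clus` in the shape of the END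
binder `hdec : Γ.geom.DecayExtract δ d` with `δ X = a″·(d(X) + (ν+1))`, `d γ = a″·(d(γ) + (ν+1))`.
[cite: Balaban1988RG2Cluster, (2.27) p.18 and (2.13) p.14; Balaban1987RG1, p.257] -/
theorem msChart_decayExtract_linSize {a'' : ℝ} (ha'' : 0 ≤ a'') :
    (msChart ν n BgA BgB gauge gauge_nonneg transport).geom.DecayExtract (fun X => a'' * ((linSize X.2.1 : ℝ) + (ν + 1)))
      (fun γ => a'' * ((msLinSize (n := n) γ : ℝ) + (ν + 1))) :=
  fun X K hK => sum_linSizeWeight_ge_of_mem_clus ν n BgA BgB gauge gauge_nonneg transport ha'' X K hK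

/-- **`PinBudget` ON THE MULTI-SCALE CHART, `κ ≤ a″` EXACTLY (kernel).**  The carriers' decay length IS the linear size
(`NE9MultiScaleChart.d_eq`), the pin is one cube: `a₁·e^{−a″(d(X) + ν + 1)} ≤ a₁·e^{−a″(ν+1)}·e^{−κ·d(X)}` for `κ ≤ a″` —
the ADDITIVE
comparability, envelope `B = a₁·e^{−a″(ν+1)}`. [cite: Balaban1988RG2Cluster, (2.40)-(2.41) p.21 and (2.30) p.18] -/
theorem msChart_pinBudget_linSize {a₁ a'' κ : ℝ} (ha₁ : 0 ≤ a₁) (hκ : κ ≤ a'') :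
    (msChart ν n BgA BgB gauge gauge_nonneg transport).geom.PinBudget
      ((msChart ν n BgA BgB gauge gauge_nonneg transport).supported.sizeWeight a₁)
      (fun X => a'' * ((linSize X.2.1 : ℝ) + (ν + 1)))
      (fun _ => a₁ * Real.exp (-(a'' * (ν + 1)))) κ := by
  intro k X _
  have hpin : (msChart ν n BgA BgB gauge gauge_nonneg transport).supported.sizeWeight a₁
      ((msChart ν n BgA BgB gauge gauge_nonneg transport).geom.pin X) = a₁ := by
    simp [Supported.sizeWeight]
  rw [hpin, mul_assoc, ← Real.exp_add, d_eq]
  have hls : (0 : ℝ) ≤ (linSize X.2.1 : ℝ) := Nat.cast_nonneg _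
  exact mul_le_mul_of_nonneg_left (Real.exp_le_exp.2 (by nlinarith)) ha₁

end Chart

end Summit.QuantumFields.BalabanUV.T4Continuum.NE9LinSizeKPMultiScale

end
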